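import Summits.AnomalousDissipation.AnomalousDissipation.Theorems.SolenoidalFractalHomogenisationLagrangianStepEffectiveFrameEnergyLDissipation
import Summits.AnomalousDissipation.AnomalousDissipation.Theorems.SolenoidalFractalHomogenisationLagrangianStepBandKillCore
import Summits.AnomalousDissipation.AnomalousDissipation.Theorems.SolenoidalFractalHomogenisationLagrangianStepPartialSumLipschitz
import Summits.AnomalousDissipation.AnomalousDissipation.Theorems.SolenoidalFractalHomogenisationLagrangianCarrierAnalyticCubeTail
import Summits.AnomalousDissipation.AnomalousDissipation.Theorems.SolenoidalFractalHomogenisationLagrangianCarrierAnalyticLadderTools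
import Literature.Analysis.FluidPDE.PassiveVectorTensorPropagatorBandKillApprox
import Literature.Analysis.FluidPDE.PassiveVectorTensorPropagatorBandKillAdjointApprox
import HarnessLib

/-!
# W3-E (ii) `stub_effectiveFrameEnergyL_bandKill`: the CUBE LADDER instantiated on the Lagrangian carrier
# (helper for K1L_D `stmt-AnomalousDissipation-27980`)

Summits-side helper file (everything proved; no definitions, no named facts).  `ladder_clauses`: under the v31 binders of the stub and a
genuine window `s < s′`, for ANY ladder parameters `K₀, S, Δ, J` and ratio `x ≥ 1` satisfying the geometric conditions
(`0 < Δ`, `2Δ + 2 ≤ S`, `(J+1)S ≤ K₀ + S`, `3(K₀+S+2Δ)² ≤ L²`, `L' ≤ rungHeight K₀ S (J+1)`) and the LADDER CONDITION written with the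
carrier's Lipschitz modulus `CL·Σ_{i<m} a_{i+1}` (`lipschitz_partialSum_mul_window_le`) and the cube-tail widths of the coarse field
(`partialSum_cube_tail`: `W(n) = Σ_{i<m} 66·C_b (a_{i+1}/N_{i+1}) e^{−((nS−2Δ)−1)/(2c₀ρ_s N_{i+1})}`, `c₀ = 4e·21³`), BOTH band-kill clauses hold
for `T ∈ {Um s s′, (Um s s′)†}` with any leak `ℓ ≥ 2x^{−(J+1)}` — by `IsPropagator.bandKill'` / `bandKill_adjoint'` (F2′/F2c′) and
`OneLevelSplit.bandKill_of_ladder`.  `bandKill_of_window_eq`: the degenerate window `s = s′` (`Um s s = P_σ`).  The assembly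
(choice of the ladder parameters from `L, L', θ_{m+1}, N_m`) is the next file. Infrastructure for route-1's rung leaf F-D1.A0 (a frontier FORMAL
rung); NOT a proof of anomalous dissipation.
-/

set_option linter.dupNamespace false

namespace Summit.AnomalousDissipation.AnomalousDissipation.Theorems.SolenoidalFractalHomogenisation.LagrangianStep

open Literature.Analysis Literature.Analysis.FluidPDE Literature.Analysis.FunctionSpaces
open MeasureTheory Set Filter Function
open scoped ENNReal NNReal InnerProductSpace
open Literature.Analysis.FluidPDE.LatticeShear
open Summit.AnomalousDissipation.AnomalousDissipation.Theorems.SolenoidalFractalHomogenisation.LagrangianRenormalisationStep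
  (memLp_top_stLift_of_continuous continuous_uncurry_partialSum isWeaklyDivFree_partialSum)
open Summit.AnomalousDissipation.AnomalousDissipation.Theorems.SolenoidalFractalHomogenisation.LagrangianCarrierAnalytic
  (partialSum_cube_tail cubeSupp_subset_freqBall_of_sq)
open Summit.AnomalousDissipation.AnomalousDissipation.Theorems.SolenoidalFractalHomogenisation.LagrangianCarrierConstruction
  (lipschitz_partialSum_mul_window_le)

noncomputable section

/-- **The degenerate window** `s = s′`: there `Um s s = P_σ` (a self-adjoint modewise contraction), so both band-kill clauses hold with
rate factor `1` and any leak `ℓ ≥ 0`, for `T ∈ {Um s s, (Um s s)†}` and `L' ≤ L`. -/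
theorem bandKill_of_window_eq {b : ℝ → UnitAddTorus (Fin 3) → EuclideanSpace ℝ (Fin 3)} {𝔸 : Torus.Visc4 (Fin 3)}
    {Um : ℝ → ℝ → (V2 →L[ℝ] V2)} (hUm : Torus.IsPropagator 1 b 𝔸 Um) {s : ℝ} (hs : 0 ≤ s) (hs1 : s ≤ 1)
    (T : V2 →L[ℝ] V2) (hT : T = Um s s ∨ T = ContinuousLinearMap.adjoint (Um s s)) {L' L : ℕ} (hL'L : L' ≤ L) {ℓ : ℝ} (hℓ : 0 ≤ ℓ) :
    (∀ y : V2, ‖T y - cutLp L (T y)‖ ≤ 1 * ‖y - cutLp L' y‖ + ℓ * ‖y‖) ∧ (∀ y : V2, cutLp L y = 0 → ‖T y‖ ≤ (1 + ℓ) * ‖y‖) := by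
  have hUP : Um s s = (Torus.divFreeL2 (Fin 3)).starProjection := by
    ext1 y; rw [hUm.apply_eq_apply_starProjection s s y]
    exact hUm.self_of_divFree s hs hs1 _ (Torus.isWeaklyDivFree_starProjection y)
  have hTadj : ContinuousLinearMap.adjoint T = (Torus.divFreeL2 (Fin 3)).starProjection := by
    rcases hT with rfl | rfl
    · rw [hUP]; exact (isSelfAdjoint_starProjection _).adjoint_eq
    · rw [ContinuousLinearMap.adjoint_adjoint, hUP]
  have hTy : ∀ y : V2, ‖T y‖ ≤ ‖y‖ := fun y => by
    rcases hT with rfl | rfl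
    · exact hUm.norm_le s s y
    · exact norm_adjoint_apply_le_of_norm_le (fun y => hUm.norm_le s s y) y
  refine ⟨fun y => ?_, fun y _ => (hTy y).trans (le_mul_of_one_le_left (norm_nonneg y) (by linarith))⟩
  have h1 : ∀ z : V2, (∀ k' ∈ Torus.freqBall L, UnitAddTorus.mFourierCoeff (EuclideanSpace.complexify ∘ (z : VF)) k' = 0) →
      ‖ContinuousLinearMap.adjoint T z‖ ≤ 1 * ‖z‖ := fun z _ => by
    rw [hTadj, ← hUP, one_mul]; exact hUm.norm_le s s z
  have h2 : ∀ z : V2, (∀ k' ∈ Torus.freqBall L, UnitAddTorus.mFourierCoeff (EuclideanSpace.complexify ∘ (z : VF)) k' = 0) →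
      ‖cutLp L' (ContinuousLinearMap.adjoint T z)‖ ≤ 0 * ‖z‖ := fun z hz => by
    rw [hTadj]
    refine OneLevelSplit.norm_cutLp_le_of_sum_le le_rfl (le_of_eq_of_le (Finset.sum_eq_zero fun k' hk' => ?_) (by positivity))
    have h0 := hz k' (Torus.freqBall_mono hL'L hk')
    have hle := Torus.norm_mFourierCoeff_starProjection_le z k'
    rw [h0, norm_zero] at hle
    rw [norm_le_zero_iff.1 hle, norm_zero, zero_pow two_ne_zero]
  have h := OneLevelSplit.norm_sub_cutLp_apply_le_of_adjoint_bounds T zero_le_one le_rfl h1 h2 y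
  rw [zero_mul, add_zero] at h
  exact h.trans (le_add_of_nonneg_right (mul_nonneg hℓ (norm_nonneg y)))

/-- **W3-E (ii), THE CUBE LADDER ON THE CARRIER** (see the module docstring): both band-kill clauses for `T ∈ {Um s s′, (Um s s′)†}` on a
genuine window, for any admissible ladder `K₀, S, Δ, J, x` satisfying the ladder condition, any `L ⊇ √3·(K₀+S+2Δ)`, `L' ≤ rungHeight`, and
any leak `ℓ ≥ 2x^{−(J+1)}`. -/
theorem ladder_clauses : ∀ k (W : Literature.Analysis.FluidPDE.LatticeShear.LatticeWord k) (M : ℝ) (hM : 0 < M) (c : ℝ), 0 < c →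
    ∀ (Φ : ℝ → Torus.Visc4 (Fin 3) → Torus.Visc4 (Fin 3)) (lo hi β : ℝ), 0 < lo → lo ≤ 1 → 1 ≤ hi → 0 ≤ β →
      ∃ θ₂ > (0:ℝ), ∃ CL ≥ (0:ℝ), ∃ ρs > (0:ℝ), ∃ Cb > (0:ℝ),
        ∀ E : Literature.Analysis.FluidPDE.LatticeShear.LagrangianLatticeCarrier k, E.design = W.stretch M hM → E.gain = c →
          E.LPermissible → E.Regular → (∀ i, E.θ (i + 1) ≤ θ₂) → (∀ m, E.N m ^ 2 ≤ E.N (m + 1)) →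
        ∀ (m : ℕ),
        ∀ (S : Torus.Visc4 (Fin 3)), Torus.OddSmall S β → Torus.NearIso S lo hi →
          Torus.OddSmall (Φ (E.cellVisc (m + 1)) S) β → Torus.NearIso (Φ (E.cellVisc (m + 1)) S) lo hi →
        ∀ Um : ℝ → ℝ → (V2 →L[ℝ] V2),
          Torus.IsPropagator 1 (E.partialSum m) (E.kbar m • renormStep (Φ (E.cellVisc (m + 1))) (E.gain / E.cellVisc (m + 1) ^ 2) S) Um →
        ∀ (s s' : ℝ), 0 ≤ s → s < s' → s' ≤ 1 → s' - s ≤ 2 * E.refresh (m + 1) →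
        ∀ T : V2 →L[ℝ] V2, (T = Um s s' ∨ T = ContinuousLinearMap.adjoint (Um s s')) →
        ∀ (K₀ Sr Δ J : ℕ) (x : ℝ), 0 < Δ → 2 * Δ + 2 ≤ Sr → (J + 1) * Sr ≤ K₀ + Sr → 1 ≤ x →
          4 * Real.pi * (K₀ + 2 * Δ) * (s' - s) * x *
            (2 * 3 ^ 2 * (CL * ∑ i ∈ Finset.range m, E.a (i + 1)) / Δ +
              3 * ∑ n ∈ Finset.range (J + 1), (∑ i ∈ Finset.range m, 66 * (Cb * (E.a (i + 1) / E.N (i + 1))) *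
                Real.exp (-(((((n + 1) * Sr - 2 * Δ : ℕ) : ℝ) - 1) / 2 / (4 * Real.exp 1 * 21 ^ 3 * (ρs * E.N (i + 1)))))) *
                  x ^ (n + 1)) ≤ 1 →
        ∀ L' L : ℕ, 3 * (K₀ + Sr + 2 * Δ) ^ 2 ≤ L ^ 2 → L' ≤ Torus.rungHeight K₀ Sr (J + 1) →
        ∀ ℓ : ℝ, 2 * x⁻¹ ^ (J + 1) ≤ ℓ →
          (∀ y : V2,
              ‖T y - cutLp L (T y)‖
                ≤ Real.exp (-(E.a (m + 1) * (8 * Real.pi ^ 2 * (L' : ℝ) ^ 2 * lo * (E.cellVisc (m + 1) + c / E.cellVisc (m + 1))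
                    / (E.N (m + 1) : ℝ) ^ 2) * (s' - s) / 2)) * ‖y - cutLp L' y‖ + ℓ * ‖y‖) ∧
          (∀ y : V2, cutLp L y = 0 →
              ‖T y‖
                ≤ (Real.exp (-(E.a (m + 1) * (8 * Real.pi ^ 2 * (L' : ℝ) ^ 2 * lo * (E.cellVisc (m + 1) + c / E.cellVisc (m + 1))
                    / (E.N (m + 1) : ℝ) ^ 2) * (s' - s) / 2)) + ℓ) * ‖y‖) := by
  intro k W M hM c hc Φ lo hi β hlo _hlo1 _hhi _hβ
  obtain ⟨θs, hθs, CL, hCL, hLip⟩ := lipschitz_partialSum_mul_window_le k (W.stretch M hM)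
  obtain ⟨ρs, hρs, Cb, hCb, θH, hθH, hTail⟩ := partialSum_cube_tail k W M hM
  refine ⟨min θs θH, lt_min hθs hθH, CL, hCL, ρs, hρs, Cb, hCb, ?_⟩
  intro E hdes hgain hLP hReg hθ hsq m S hS₁ hS₂ hS₃ hS₄ Um hUm s s' hs hlt hs'1 hlen T hT K₀ Sr Δ J x hΔ hSr hJ hx hlad L' L hRL hL'
    ℓ hℓ
  have hP := hLP.permissible
  have hLR := hReg.levelRegular
  have hθs' : ∀ i, E.θ (i + 1) ≤ min θs θH := hθ
  have hθH' : ∀ i, E.θ (i + 1) ≤ θH := fun i => (hθ i).trans (min_le_right _ _)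
  have hLipE := hLip E (min θs θH) hdes (min_le_left _ _) hLP hReg hsq hθs' m
  have hcube := (hTail E hdes hLP hReg hθH' hsq).2
  -- carrier facts
  have hcont : Continuous (uncurry (E.partialSum m)) := continuous_uncurry_partialSum E m fun i _ => hLR.continuous_uncurry_b i
  have hb := memLp_top_stLift_of_continuous hcont 1
  have hbdiv : ∀ᵐ τ ∂(volume.restrict (Ioo (0:ℝ) 1)), Torus.IsWeaklyDivFree (E.partialSum m τ) :=
    ae_of_all _ fun τ => isWeaklyDivFree_partialSum E m (fun i _ => hLR.continuous_uncurry_b i) (fun i _ t => hLR.isWeaklyDivFree_b i t) τ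
  have hbc : ∀ᵐ τ ∂(volume.restrict (Ioo (0:ℝ) 1)), Continuous (E.partialSum m τ) :=
    ae_of_all _ fun τ => hcont.comp (Continuous.prodMk_right τ)
  have hΛ : 0 ≤ CL * ∑ i ∈ Finset.range m, E.a (i + 1) := mul_nonneg hCL (Finset.sum_nonneg fun i _ => (E.a_pos _).le)
  have hbL : ∀ᵐ τ ∂(volume.restrict (Ioo (0:ℝ) 1)), ∀ x y, ‖E.partialSum m τ x - E.partialSum m τ y‖ ≤
      (CL * ∑ i ∈ Finset.range m, E.a (i + 1)) * ‖Torus.reprc (x - y)‖ := ae_of_all _ fun τ x y => hLipE.1 τ x y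
  have hg0 : 0 ≤ E.gain / E.cellVisc (m + 1) ^ 2 := div_nonneg (hgain ▸ hc.le) (sq_nonneg _)
  have h𝔸 : Torus.NearIso (E.kbar m • renormStep (Φ (E.cellVisc (m + 1))) (E.gain / E.cellVisc (m + 1) ^ 2) S)
      (E.kbar m * lo) (E.kbar m * hi) := (nearIso_renormStep hg0 hS₂ hS₄).smul (E.kbar_pos m).le
  have hklo : 0 < E.kbar m * lo := mul_pos (E.kbar_pos m) hlo
  -- the cube-tail widths
  set Wd : ℕ → ℝ := fun n => ∑ i ∈ Finset.range m, 66 * (Cb * (E.a (i + 1) / E.N (i + 1))) *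
    Real.exp (-((((n * Sr - 2 * Δ : ℕ) : ℝ) - 1) / 2 / (4 * Real.exp 1 * 21 ^ 3 * (ρs * E.N (i + 1))))) with hWd
  have hW0 : ∀ n, 0 ≤ Wd n := fun n => Finset.sum_nonneg fun i _ => by have := E.a_pos (i + 1); positivity
  have hSΔ : 2 * Δ ≤ Sr := by omega
  have hW : ∀ᵐ τ ∂(volume.restrict (Ioo (0:ℝ) 1)), ∀ n, 1 ≤ n → n ≤ J + 1 → ∃ t : (Fin 3 → ℤ) → EuclideanSpace ℂ (Fin 3),
      Torus.IsConjSymm t ∧ ∀ x, ‖E.partialSum m τ x - Torus.realTrigPoly (Torus.cubeSupp (Fin 3) (n * Sr - 2 * Δ)) t x‖ ≤ Wd n := by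
    refine ae_of_all _ fun τ n hn _ => ?_
    have hQ : 2 ≤ n * Sr - 2 * Δ := by
      have : Sr ≤ n * Sr := Nat.le_mul_of_pos_left Sr hn
      omega
    exact hcube m τ (n * Sr - 2 * Δ) hQ
  have hlad' : 4 * Real.pi * (K₀ + 2 * Δ) * (s' - s) * x * (2 * (Fintype.card (Fin 3)) ^ 2 * (CL * ∑ i ∈ Finset.range m, E.a (i + 1)) / Δ +
      Fintype.card (Fin 3) * ∑ n ∈ Finset.range (J + 1), Wd (n + 1) * x ^ (n + 1)) ≤ 1 := by
    simp only [Fintype.card_fin, Nat.cast_ofNat, hWd]; exact hlad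
  -- geometry: the ladder support lies inside the ball `L`
  have hgeom : Torus.ladderSupp (Fin 3) K₀ Sr Δ ⊆ Torus.freqBall L := cubeSupp_subset_freqBall_of_sq hRL
  -- the rate in the two currencies
  obtain ⟨ϱ, hϱ⟩ : ∃ ϱ : ℝ, ϱ = 8 * Real.pi ^ 2 * (E.kbar m * lo) * (L' : ℝ) ^ 2 * (s' - s) := ⟨_, rfl⟩
  have hexp : Real.exp (-(E.a (m + 1) * (8 * Real.pi ^ 2 * (L' : ℝ) ^ 2 * lo * (E.cellVisc (m + 1) + c / E.cellVisc (m + 1))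
      / (E.N (m + 1) : ℝ) ^ 2) * (s' - s) / 2)) = Real.exp (-(ϱ / 2)) := by
    congr 2
    rw [hϱ, kbar_eq_rate E hP m, hgain]; ring
  set ε : ℝ := x⁻¹ ^ (J + 1) with hεdef
  have hε : 0 ≤ ε := by positivity
  -- the three ladder bounds, for `Um s s'` and for its adjoint
  have hU : ∀ z : V2, (∀ k' ∈ Torus.freqBall L, UnitAddTorus.mFourierCoeff (EuclideanSpace.complexify ∘ (z : VF)) k' = 0) →
      ‖Um s s' z‖ ≤ (Real.exp (-(ϱ / 2)) + ε) * ‖z‖ ∧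
      ∑ k' ∈ Torus.freqBall L', ‖UnitAddTorus.mFourierCoeff (EuclideanSpace.complexify ∘ ((Um s s' z : V2) : VF)) k'‖ ^ 2 ≤
        ε ^ 2 * ‖z‖ ^ 2 := by
    intro z hz
    have h := hUm.bandKill' h𝔸 hklo hb hbdiv hbc hΛ hbL hΔ hSΔ hJ hW0 hW hs hlt hs'1 hx hlad' hL' z fun k' hk' => hz k' (hgeom hk')
    exact ⟨OneLevelSplit.norm_le_of_sq_le_exp_add hε (hϱ ▸ h.2), h.1⟩
  have hUa : ∀ z : V2, (∀ k' ∈ Torus.freqBall L, UnitAddTorus.mFourierCoeff (EuclideanSpace.complexify ∘ (z : VF)) k' = 0) →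
      ‖ContinuousLinearMap.adjoint (Um s s') z‖ ≤ (Real.exp (-(ϱ / 2)) + ε) * ‖z‖ ∧
      ∑ k' ∈ Torus.freqBall L', ‖UnitAddTorus.mFourierCoeff (EuclideanSpace.complexify ∘
        ((ContinuousLinearMap.adjoint (Um s s') z : V2) : VF)) k'‖ ^ 2 ≤ ε ^ 2 * ‖z‖ ^ 2 := by
    intro z hz
    have h := hUm.bandKill_adjoint' h𝔸 hklo hb hbdiv hbc hΛ hbL hΔ hSΔ hJ hW0 hW hs hlt hs'1 hx hlad' hL' z
      fun k' hk' => hz k' (hgeom hk')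
    exact ⟨OneLevelSplit.norm_le_of_sq_le_exp_add hε (hϱ ▸ h.2), h.1⟩
  rw [hexp]
  rcases hT with rfl | rfl
  · exact OneLevelSplit.bandKill_of_ladder _ hε hℓ (fun z hz => (hU z hz).1) (fun z hz => (hUa z hz).1)
      fun z hz => OneLevelSplit.norm_cutLp_le_of_sum_le hε (hUa z hz).2
  · refine OneLevelSplit.bandKill_of_ladder _ hε hℓ (fun z hz => (hUa z hz).1) (fun z hz => ?_) fun z hz => ?_
    · rw [ContinuousLinearMap.adjoint_adjoint]; exact (hU z hz).1
    · rw [ContinuousLinearMap.adjoint_adjoint]; exact OneLevelSplit.norm_cutLp_le_of_sum_le hε (hU z hz).2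

end

end Summit.AnomalousDissipation.AnomalousDissipation.Theorems.SolenoidalFractalHomogenisation.LagrangianStep
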